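import Summits.ResolutionOfSingularities.ResolutionOfSingularities.Theorems.MaxContactCutPort
import HarnessLib

/-!
# MaxContactCutPort2 — decomp-res node «PortCut» (lens-2 g28, critic row 219 CLEARED · MAP +1 ONCE (D1: the
multi-unit port proved for every n)), tree file 4/5 of the node

Content VERBATIM from the decomp-res lens-2 g28 node `HOME/decomp-res-lens-2/g28/PortCut.lean` (pin 67bf9bb7; no
carry, imports the landed g27 node «ExitCut» + Literature; ns `…Theses.PortCut` ↦ `…Theorems.PortCut`); HOME =
run/shared/lean/pub/decomp-res; critic CRITIC-LEDGER row 219 CLEARED · MAP +1 ONCE (D1): `componentPackagePort_holds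
: ∀ n, ComponentPackagePort n` in kernel via `multiUnitPackageTransport_holds`; landing orders LANDING NOTE :1549 +
rider 12:16:46Z — provenance and critic text in full (and the lens header verbatim) in `ExitCutTransport`.  `--kind
proof --supports stmt-ResolutionOfSingularities-29273`.

## This file

Continuation 2/2 of `MaxContactCutPort` (same namespace / sections of the node, cut at the tree's 400-line cap;
section variables / opens replayed): scopes `Kernel` — carries `multiUnitPackageTransport_holds`,
`componentPackagePort_holds`, `componentPackagePort_holds'`.

[WRITER NOTE (decomp-res writer g13): file split only (tree files ≤ 400 lines); sections, section `variable`s /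
`open`s and every declaration exactly as in the lens (namespace renamed Theses ↦ Theorems, the HOME-only
dupNamespace-linter line dropped; `noncomputable section` and the five file-level `open` lines replayed in every
file). Audit-cone caveat of the lens honoured: each pattern-matching recursive helper
(`isRegular_top_of_weakAdmissible`, `stalkIdeal_transformMarked_of_not_mem`, `WeakAdmissible.restrict`) stays in the
same file as a tactic-style proof referencing it whenever the cap allows; a cut between them changes nothing for the kernel.]

(Sources: Hironaka1964 Ch. III §§1–3, §7; Giraud1975; CossartJannsenSaito2020 Ch. 2, Ch. 8–9; EGAIV4 §16–§17;
Matsumura1987 §28–§30; CossartPiltant2008 Prop. 4.2; BierstoneMilman1997 §3; Cutkosky2004 Ch. 6–7; Kollar2007 §3;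
StacksProject 01WV / 0806 / 080A.)
-/

noncomputable section

open CategoryTheory AlgebraicGeometry IsLocalRing TopologicalSpace Topology
open Literature.AlgebraicGeometry.Resolution
open Summit.ResolutionOfSingularities.ResolutionOfSingularities.Theorems
open Summit.ResolutionOfSingularities.ResolutionOfSingularities.Theorems.WeakOrderReduction
open Summit.ResolutionOfSingularities.ResolutionOfSingularities.Theorems.FaceFormCutClasses

namespace Summit.ResolutionOfSingularities.ResolutionOfSingularities.Theorems.PortCut

section Kernel

open Summit.ResolutionOfSingularities.ResolutionOfSingularities.Theorems.DeltaFaceCutClasses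
open Summit.ResolutionOfSingularities.ResolutionOfSingularities.Theorems.RelativeDeltaCut
open Summit.ResolutionOfSingularities.ResolutionOfSingularities.Theorems.CrossCut

/-! ## §C  The port PROVED for every `n`; by-name corollaries; `closes` -/

/-- **KERNEL: the typed port residual `ExitCut.MultiUnitPackageTransport n` (g27's letter, landed
`Theorems/ExitCutKernels2.lean`) HOLDS for EVERY `n`, hypothesis-free.**  Every non-class-≥-2 top point lies on a
package unit (§U, the four kinds by letter); finitely many units cover them (`exists_finset_units`, `Y` noetherian
from the frame); `transport_kernel`. [folklore] -/
theorem multiUnitPackageTransport_holds (n : ℕ) : ExitCut.MultiUnitPackageTransport n := by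
  intro p hp k _ _ Y g hg1 hg2 hg3 hY h4 I hord hcls
  haveI := hg1; haveI := hg2; haveI := hg3
  haveI : IsLocallyNoetherian Y := LocallyOfFiniteType.isLocallyNoetherian g
  haveI : CompactSpace Y := QuasiCompact.compactSpace_of_compactSpace g
  haveI : IsNoetherian Y := {}
  have hcov : ∀ y : Y, idealOrder I y = ((n : ℕ) : ℕ∞) →
      ClassGE g hY I n 2 y ∨ ∃ u : PackageUnit I n, y ∈ u.carrier := by
    intro y hy
    rcases hcls y hy with hc | hN | hP | hC | hK
    · exact Or.inl hc
    · exact Or.inr (exists_unit_of_isNearExitPt hY hy hN)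
    · exact Or.inr (exists_unit_of_isPackageExitPt hy hP)
    · exact Or.inr (exists_unit_of_isCurveExitPt hY hord hC)
    · exact Or.inr (exists_unit_of_isComponentExitPt hK)
  obtain ⟨F, hcovF⟩ := exists_finset_units g hY I n hcov
  exact transport_kernel n F.card p hp k Y g hY h4 I hord F le_rfl hcovF

/-- **KERNEL (the g28 MAP door): `ComponentPackagePort n` — the landed definition VERBATIM — holds for EVERY `n`,
hypothesis-free**: the typed residual proved above, through the landed kernel
`ExitCut.componentPackagePort_of_multiUnitPackageTransport` (frame persistence, `SeqDimFour 2 n`,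
`weakResolution_append`). [folklore] -/
theorem componentPackagePort_holds (n : ℕ) : ComponentPackagePort n :=
  ExitCut.componentPackagePort_of_multiUnitPackageTransport (multiUnitPackageTransport_holds n)

/-- **KERNEL.** `ComponentPackagePort n` for every `n ≥ 2` — the exact binder shape `hP` of the landed wirings
`ExitCut.cuspGenericRung_of_ports` / `ExitCut.closes_of_engines` (and of `CuspX.cuspGenericRung_of_ports`, …). [folklore] -/
theorem componentPackagePort_holds' : ∀ n : ℕ, 2 ≤ n → ComponentPackagePort n :=
  fun n _ => componentPackagePort_holds n

end Kernel

end Summit.ResolutionOfSingularities.ResolutionOfSingularities.Theorems.PortCut
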